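import Literature.Analysis.FluidPDE.NSBoundedMildWeightedBilinear
import Literature.Analysis.FluidPDE.NSBoundedMildWeightedHeat
import Literature.Analysis.FluidPDE.OseenDuhamelLimits
import Literature.Analysis.FunctionSpaces.ContDiffOnLimit
import HarnessLib

/-!
# KNSS 2009, Prop. 4.1: the limit of the weighted Picard iteration

Analysis/FluidPDE proof file (everything proved, no definitions) on the discharge path of the
named fact `Literature.Analysis.FluidPDE.knss2009_local_smoothing` (`NSBoundedMildSmoothing.lean`;
Koch–Nadirashvili–Seregin–Šverák, Acta Math. 203 (2009) = arXiv:0709.3599, §4 p. 8, Prop. 4.1: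
the integral equation `u = U + B(u,u)` ((4.3)) "can be solved … for sufficiently small `T` by a
fixed point argument", in "spaces with norms given by the expression on the left-hand side of
(4.5)", `‖t^{k/2+l}∇ᵏₓ∂ₜˡu‖_{L^∞}`). `NSBoundedMildWeightedPicard.lean` runs the iteration
`u₀ = U`, `u_{m+1} = U - B^ν_0(u_m, u_m)` (`oseenPicardSeq`) in the weighted classes
`IsWeightedSmooth` / `HasWeightedBound` of `ParabolicRescale.lean`, given the weighted heat
estimate (H) and the weighted bilinear estimate (B) of order `N` (both discharged:
`WeightedHeatEstimate_holds`, `WeightedBilinearEstimate_holds`): the iterates keep the bounds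
`2K'M` of orders `≤ N` (`oseenPicardSeq_invariant`) and their differences contract,
`K'M/2^m` (`oseenPicardSeq_sub_bound`). This file takes **the limit**
(`exists_oseenMild_of_weighted_estimates`): under the smallness `A √(T/ν) (2K'M) ≤ 1/4` there is
a field `u` on the slab `(0, T) × E` with

* `u(t, x) = lim_m u_m(t, x)` (the differences are pointwise `≤ K'M/2^m`, `HasWeightedBound.norm_le`);
* `uncurry u` jointly `C^N` on the slab and `HasWeightedBound ν T N u (2K'M)`: at every scale
  `t₀ ∈ (0, T)` the rescaled iterates `parabolicRescale ν t₀ u_m` are `C^∞` on the open set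
  `(1/4, T/t₀) × E ∋ (1, ξ)`, where all their derivatives of orders `≤ N` differ by
  `≤ 4^N K'M/2^m` (`HasWeightedBound.norm_iteratedFDeriv_le`), so they converge with their
  derivatives (the `C^N` limit theorem `contDiffOn_of_uniformCauchySeqOn_iteratedFDeriv` and
  `tendstoLocallyUniformlyOn_iteratedFDeriv_of_uniformCauchySeqOn` of `ContDiffOnLimit.lean`,
  Rudin Thm. 7.17 iterated); smoothness on the slab follows scale by scale
  (`contDiffOn_uncurry_of_parabolicRescale`) and the bounds at unit height pass to the limit;
* `u(t, x) = e^{νtΔ}a(x) - B^ν_0(u, u)(t)(x)` for all `t ∈ (0, T)`, `x` — the limit in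
  `u_{m+1} = U - B^ν_0(u_m, u_m)`, the Duhamel term converging by dominated convergence along the
  uniformly bounded, pointwise convergent sequence (`tendsto_oseenDuhamel_of_tendsto_of_bound`,
  KNSS 2009, Lemma 4.1).

The mixed-derivative form (4.5) of `knss2009_local_smoothing` (initial time `s`, data bounded
a.e., the weights `(ν(t-s))^{k/2}(t-s)^l`) is read off in the sequel.

## References

* G. Koch, N. Nadirashvili, G. Seregin, V. Šverák, *Liouville theorems for the Navier–Stokes
  equations and applications*, Acta Math. 203 (2009) = arXiv:0709.3599, §4 p. 8: (4.3)–(4.5),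
  Prop. 4.1, Lemma 4.1, Remark 4.2. [KochNadirashviliSereginSverak2009]
* Y. Giga, K. Inui, S. Matsui, *On the Cauchy problem for the Navier–Stokes equations with
  nondecaying initial data*, Quad. Mat. 4 (1999) (the weighted iteration for `L^∞` data).
* P. G. Lemarié-Rieusset, *The Navier–Stokes problem in the 21st century* (2016), Thm. 5.1
  (Picard contraction). [LemarieRieusset2016]
* W. Rudin, *Principles of Mathematical Analysis*, 3rd ed. (1976), Thm. 7.17.
-/

noncomputable section

open MeasureTheory Set Function Filter Metric Real
open _root_.Topology
open scoped ENNReal NNReal ContDiff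

namespace Literature.Analysis.FluidPDE

open UnboundedOperators (heatExtension)
open Literature.Analysis.FunctionSpaces

variable {E : Type*} [NormedAddCommGroup E] [InnerProductSpace ℝ E] [FiniteDimensional ℝ E]
  [MeasurableSpace E] [BorelSpace E]

section Limit

variable {ν T M : ℝ} {a : E → E} {N : ℕ} {K A K' : ℝ}

/-- **The limit of the weighted Picard iteration** (KNSS 2009, Prop. 4.1; Giga–Inui–Matsui
1999). Under the weighted heat estimate (H) of order `N` with constant `K ≤ K'`, the weighted
bilinear estimate (B) of order `N` with constant `A`, and the smallness
`A √(T/ν) (2K'M) ≤ 1/4` of the slab `(0, T)`, for every measurable datum `a` with `‖a‖ ≤ M`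
there is a field `u` on `(0, T) × E`, the pointwise limit of the Picard iterates
`oseenPicardSeq ν a m`, which is jointly `C^N` on the slab, has scale-invariant bounds `2K'M` of
orders `≤ N` (`HasWeightedBound`, the isotropic form of (4.5)), is bounded by `2K'M`, and solves
`u(t, x) = e^{νtΔ}a(x) - B^ν_0(u, u)(t)(x)` for all `t ∈ (0, T)` and all `x` ((4.3)).
[cite: KochNadirashviliSereginSverak2009, Prop. 4.1 with (4.3)–(4.5) (arXiv:0709.3599 p. 8)] -/
theorem exists_oseenMild_of_weighted_estimates
    (hH : ∀ ⦃ν T M : ℝ⦄, 0 < ν → 0 < T → 0 ≤ M → ∀ ⦃a : E → E⦄,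
      AEStronglyMeasurable a volume → (∀ x, ‖a x‖ ≤ M) →
      IsWeightedSmooth ν T (fun t x => heatExtension a (ν * t) x) ∧
      HasWeightedBound ν T N (fun t x => heatExtension a (ν * t) x) (K * M))
    (hB : ∀ ⦃ν T : ℝ⦄, 0 < ν → 0 < T → ∀ ⦃v w : ℝ → E → E⦄,
      IsWeightedSmooth ν T v → IsWeightedSmooth ν T w →
      IsWeightedSmooth ν T (oseenDuhamel ν 0 v w) ∧
      ∀ ⦃Cv Cw : ℝ⦄, HasWeightedBound ν T N v Cv → HasWeightedBound ν T N w Cw →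
        HasWeightedBound ν T N (oseenDuhamel ν 0 v w) (A * Real.sqrt (T / ν) * Cv * Cw))
    (hν : 0 < ν) (hT : 0 < T) (hM : 0 ≤ M) (ham : AEStronglyMeasurable a volume)
    (haM : ∀ x, ‖a x‖ ≤ M) (hKK' : K ≤ K')
    (hsmall : A * Real.sqrt (T / ν) * (2 * K' * M) ≤ 1 / 4) :
    ∃ u : ℝ → E → E,
      ContDiffOn ℝ N (uncurry u) (Ioo 0 T ×ˢ univ) ∧
      HasWeightedBound ν T N u (2 * K' * M) ∧
      (∀ t ∈ Ioo 0 T, ∀ x, ‖u t x‖ ≤ 2 * K' * M) ∧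
      (∀ t ∈ Ioo 0 T, ∀ x, u t x = heatExtension a (ν * t) x - oseenDuhamel ν 0 u u t x) ∧
      ∀ t ∈ Ioo 0 T, ∀ x, Tendsto (fun m => oseenPicardSeq ν a m t x) atTop (𝓝 (u t x)) := by
  -- the invariants and the contraction of the iterates
  have hK'M : K * M ≤ K' * M := mul_le_mul_of_nonneg_right hKK' hM
  have hK'0 : 0 ≤ K' * M := by
    obtain ⟨-, hUb⟩ := hH hν hT hM ham haM
    haveI : Nonempty E := ⟨0⟩
    exact (hUb.nonneg hT).trans hK'M
  have hsmall' : A * Real.sqrt (T / ν) * (2 * K' * M) * (2 * K' * M) ≤ K' * M := by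
    have h2 : 0 ≤ 2 * K' * M := by linarith
    calc A * Real.sqrt (T / ν) * (2 * K' * M) * (2 * K' * M) ≤ 1 / 4 * (2 * K' * M) :=
          mul_le_mul_of_nonneg_right hsmall h2
      _ = K' * M / 2 := by ring
      _ ≤ K' * M := by linarith
  have hinv := oseenPicardSeq_invariant hH hB hν hT hM ham haM hKK' hsmall'
  have hdiff := oseenPicardSeq_sub_bound hH hB hν hT hM ham haM hKK' hsmall
  -- (1) pointwise differences and the pointwise limit on the slab
  have hptw : ∀ m, ∀ t ∈ Ioo 0 T, ∀ x,
      ‖oseenPicardSeq ν a (m + 1) t x - oseenPicardSeq ν a m t x‖ ≤ K' * M / 2 ^ m := by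
    intro m t ht x
    have h := (hdiff m).norm_le hν ht x
    simpa only [Pi.sub_apply] using h
  set u : ℝ → E → E := fun t x => limUnder atTop (fun m => oseenPicardSeq ν a m t x) with hu
  have hlim : ∀ t ∈ Ioo 0 T, ∀ x, Tendsto (fun m => oseenPicardSeq ν a m t x) atTop (𝓝 (u t x)) := by
    intro t ht x
    have hc : CauchySeq fun m => oseenPicardSeq ν a m t x := by
      refine cauchySeq_of_le_geometric (1 / 2) (K' * M) (by norm_num) fun m => ?_
      rw [dist_comm, dist_eq_norm]
      calc ‖oseenPicardSeq ν a (m + 1) t x - oseenPicardSeq ν a m t x‖ ≤ K' * M / 2 ^ m :=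
            hptw m t ht x
        _ = K' * M * (1 / 2) ^ m := by rw [one_div_pow, mul_one_div]
    exact tendsto_nhds_limUnder (cauchySeq_tendsto_of_complete hc)
  -- (2) at every scale: the rescaled iterates converge in `C^N` near the unit height
  have hresc : ∀ t₀ ∈ Ioo 0 T,
      ContDiffOn ℝ N (parabolicRescale ν t₀ u) (Ioo (1 / 4) (T / t₀) ×ˢ univ) ∧
      ∀ i ≤ N, ∀ ξ : E, Tendsto (fun j => iteratedFDeriv ℝ i (parabolicRescale ν t₀ (oseenPicardSeq ν a j)) (1, ξ))
        atTop (𝓝 (iteratedFDeriv ℝ i (parabolicRescale ν t₀ u) (1, ξ))) := by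
    intro t₀ ht₀
    set U₀ : Set (ℝ × E) := Ioo (1 / 4) (T / t₀) ×ˢ univ with hU₀def
    have hU₀ : IsOpen U₀ := isOpen_Ioo.prod isOpen_univ
    have hTt₀ : 1 < T / t₀ := (one_lt_div ht₀.1).2 ht₀.2
    have hmemU : ∀ p ∈ U₀, 1 / 4 < p.1 ∧ 0 < p.1 ∧ t₀ * p.1 < T := fun p hp => by
      obtain ⟨hp1, -⟩ := mem_prod.1 hp
      refine ⟨hp1.1, by linarith [hp1.1], ?_⟩
      have h := (lt_div_iff₀ ht₀.1).1 hp1.2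
      linarith [mul_comm t₀ p.1]
    -- smoothness of the rescaled iterates on `U₀`
    have hf : ∀ j, ContDiffOn ℝ N (parabolicRescale ν t₀ (oseenPicardSeq ν a j)) U₀ := fun j =>
      (((hinv j).1.contDiffOn_parabolicRescale ht₀.1).of_le (mod_cast le_top)).mono
        (prod_mono (Ioo_subset_Ioo_left (by norm_num)) subset_rfl)
    -- pointwise convergence on `U₀`
    have hfg : ∀ p ∈ U₀, Tendsto (fun j => parabolicRescale ν t₀ (oseenPicardSeq ν a j) p) atTop
        (𝓝 (parabolicRescale ν t₀ u p)) := fun p hp => by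
      simp only [parabolicRescale_apply]
      exact hlim _ ⟨mul_pos ht₀.1 (hmemU p hp).2.1, (hmemU p hp).2.2⟩ _
    -- the derivatives of orders `≤ N` are uniformly Cauchy on `U₀`
    have hC : ∀ i ≤ N, ∀ p ∈ U₀, ∃ V ∈ 𝓝 p,
        UniformCauchySeqOn (fun j => iteratedFDeriv ℝ i (parabolicRescale ν t₀ (oseenPicardSeq ν a j)))
          atTop V := by
      intro i hi p hp
      refine ⟨U₀, hU₀.mem_nhds hp, ?_⟩
      have hsum : Summable fun j : ℕ => 4 ^ i * (K' * M) * (1 / 2) ^ j :=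
        (summable_geometric_of_lt_one (by norm_num) (by norm_num)).mul_left _
      refine uniformCauchySeqOn_of_norm_sub_succ_le hsum fun j q hq => ?_
      obtain ⟨hq4, hq0, hqT⟩ := hmemU q hq
      have h1 : ContDiffAt ℝ ∞ (parabolicRescale ν t₀ (oseenPicardSeq ν a (j + 1))) q :=
        (hinv (j + 1)).1.contDiffAt_parabolicRescale ht₀.1 hq0 hqT
      have h0 : ContDiffAt ℝ ∞ (parabolicRescale ν t₀ (oseenPicardSeq ν a j)) q :=
        (hinv j).1.contDiffAt_parabolicRescale ht₀.1 hq0 hqT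
      rw [← iteratedFDeriv_sub_apply (h1.of_le (mod_cast le_top)) (h0.of_le (mod_cast le_top)),
        ← parabolicRescale_sub]
      have h := (hdiff j).norm_iteratedFDeriv_le hν ht₀.1 hq4.le hqT hi q.2
      calc ‖iteratedFDeriv ℝ i (parabolicRescale ν t₀
              (oseenPicardSeq ν a (j + 1) - oseenPicardSeq ν a j)) q‖
          ≤ 4 ^ i * (K' * M / 2 ^ j) := h
        _ = 4 ^ i * (K' * M) * (1 / 2) ^ j := by
            rw [div_eq_mul_inv, one_div, inv_pow]; ring
    refine ⟨contDiffOn_of_uniformCauchySeqOn_iteratedFDeriv hU₀ hf hfg hC, fun i hi ξ => ?_⟩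
    have h := (tendstoLocallyUniformlyOn_iteratedFDeriv_of_uniformCauchySeqOn hU₀ hf hfg hC hi).1
    exact h.tendsto_at (mk_mem_prod ⟨by norm_num, hTt₀⟩ (mem_univ ξ))
  -- (3) smoothness on the slab and the weighted bounds of the limit
  have hsmooth : ContDiffOn ℝ N (uncurry u) (Ioo 0 T ×ˢ univ) :=
    contDiffOn_uncurry_of_parabolicRescale hν fun t₀ ht₀ =>
      ⟨1 / 4, T / t₀, by norm_num, (one_lt_div ht₀.1).2 ht₀.2, (hresc t₀ ht₀).1⟩
  have hbound : HasWeightedBound ν T N u (2 * K' * M) := fun t₀ ht₀ m hm ξ =>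
    le_of_tendsto ((hresc t₀ ht₀).2 m hm ξ).norm
      (Eventually.of_forall fun j => (hinv j).2 t₀ ht₀ m hm ξ)
  have hnorm : ∀ t ∈ Ioo 0 T, ∀ x, ‖u t x‖ ≤ 2 * K' * M := fun t ht x => hbound.norm_le hν ht x
  refine ⟨u, hsmooth, hbound, hnorm, fun t ht x => ?_, hlim⟩
  -- (4) the equation in the limit
  have hsub : Ioo 0 t ×ˢ (univ : Set E) ⊆ Ioo 0 T ×ˢ univ :=
    prod_mono (Ioo_subset_Ioo_right ht.2.le) subset_rfl
  have hum : ∀ k, AEStronglyMeasurable (uncurry (oseenPicardSeq ν a k))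
      ((volume : Measure (ℝ × E)).restrict (Ioo 0 t ×ˢ univ)) := fun k =>
    (hinv k).1.aestronglyMeasurable.mono_measure (Measure.restrict_mono hsub le_rfl)
  have hu₀m : AEStronglyMeasurable (uncurry u) ((volume : Measure (ℝ × E)).restrict (Ioo 0 t ×ˢ univ)) :=
    (hsmooth.continuousOn.mono hsub).aestronglyMeasurable (measurableSet_Ioo.prod MeasurableSet.univ)
  have huM : ∀ k, ∀ τ ∈ Ioo 0 t, ∀ y, ‖oseenPicardSeq ν a k τ y‖ ≤ 2 * K' * M := fun k τ hτ y =>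
    (hinv k).2.norm_le hν ⟨hτ.1, hτ.2.trans ht.2⟩ y
  have hlim' : ∀ τ ∈ Ioo 0 t, ∀ y, Tendsto (fun k => oseenPicardSeq ν a k τ y) atTop (𝓝 (u τ y)) :=
    fun τ hτ y => hlim τ ⟨hτ.1, hτ.2.trans ht.2⟩ y
  have hD : Tendsto (fun k => oseenDuhamel ν 0 (oseenPicardSeq ν a k) (oseenPicardSeq ν a k) t x) atTop
      (𝓝 (oseenDuhamel ν 0 u u t x)) :=
    tendsto_oseenDuhamel_of_tendsto_of_bound hν (by linarith) ht.1 hum hu₀m huM hlim' x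
  have hR : Tendsto (fun k => oseenPicardSeq ν a (k + 1) t x) atTop
      (𝓝 (heatExtension a (ν * t) x - oseenDuhamel ν 0 u u t x)) := by
    simp only [oseenPicardSeq_succ_apply]
    exact tendsto_const_nhds.sub hD
  have hL : Tendsto (fun k => oseenPicardSeq ν a (k + 1) t x) atTop (𝓝 (u t x)) :=
    (hlim t ht x).comp (tendsto_add_atTop_nat 1)
  exact tendsto_nhds_unique hL hR

end Limit

end Literature.Analysis.FluidPDE

end
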